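import Summits.QuantumFields.BalabanUV.T4Continuum.Spine.NE1p.DressedSmallFieldNestedToriRod

/-!
# T⁴ programme, spine estimate NE1′ (node O3b/H2) — WITNESS «THE CLUSTER TERM IS LIVE AND THE DECAY RATE BITES»: the OWNER's torus
# face `DressedSmallFieldGeometry.attachedPart_locE_le_geom` (N0o — the geometry binder group (B4) FED from pv22's `tgeometry`)
# FIRED IN THE INTERIOR OF ITS RATE BOOKKEEPING — `r₁ = 1`, `b = 5·r₁`, `R = r₁ + 2κ₀ + 2` — ON W67's THREE-CUBE ROD `C_R` (torus tree
# length EXACTLY 1), with an activity carried by the two OVERLAPPING DOMINOES of the rod and by NO polymer whose footprint is the rod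

Cell `pub-balaban`, sub-cell `t4`, row NE1′ formalisation crew (`t4/formal/NE1p/LEAVES.md` row W⟨next⟩ — own-initiative WITNESS row under
typer R-T61 (ii); INTENT `HOME/CLAIMS.log` l.22351; the typer's row id ∕ DAG node are recorded at booking), unit
`b2b-balaban-t4-ne1p-formalise-leaf-09` (gen 13); PART 1 of 2 (D1).  ADDITIVE — imports W67 PART 1 `Spine/NE1p/DressedSmallFieldNestedToriRod`
(leaf-10 g11, p238873: the rod `C_R`, `torusTreeLen_CR`; → W59.1 → S44 ∕ S47 ∕ W53.1 → … → W24 `DressedSmallFieldTorusWitness` → S24∕N0o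
`DressedSmallFieldGeometry` → pv22 `TreeLengthTorusGeometry`) ONLY; toy DATA `def`s (the dominoes, the activity, the envelope, three numerals)
+ theorems; 0 `def … : Prop`, 0 cite, 0 sorry, 0 `attribute`; nothing of N0o ∕ S24 ∕ W24 ∕ W33 ∕ W67 ∕ pv22 ∕ b13 is restated —
`attachedPart_locE_le_geom`, `torus_consts`, `K₀_four`, W24's `hsmall_torus`∕`prefactor_pos`, W33's `Acst`∕`Acst_pos`, W67's `pR`∕`pR_zero`∕
`adj_pR`∕`rodW`∕`rodT`∕`CR`∕`CR_val`∕`natLift_proj_pR`∕`torusTreeLen_CR`, b13's `faceConnected_pair`, pv22's `tFaceConnected_image`∕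
`torusTreeLen_le_card_sub_one`∕`tsys_dj` are used BY NAME.

WHY.  The referee of this crew records at EVERY pass since pass 20 the INFO caveat (a) (`t4/formal/NE1p/REFEREE.md`, pass 24 l.22167
99a86df637c35e3c): «rate `0` in the decay factor (`exp (−(0·dj X₀))`) — the ENDs are fired at the BOUNDARY of their rate bookkeeping;
liveness is in the activity datum, not in the decay».  Every decided witness of the crew fires its face with `r₁ = 0`, `b = 0` on the ONE-CUBE
member `X₀` (tree length `0`, W24's `torusTreeLen_singleton`), with an activity supported on a polymer whose footprint IS the member, so
that `E(X₀) = log(1 + w X₀)` (W24's `exp_locE_cube`).  THIS FILE fires the OWNER's torus face (N0o `attachedPart_locE_le_geom` at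
`(tsys 4 (L·N′), tgeometry 4 (L·N′))`, the same face W24's `attached_fires_torus` fires at rate 0) with ALL THREE rate clauses at INTERIOR
values — `hb : 1·5 ≤ 5`, `hrate : 1 + 2κ₀ + 2 ≤ R₁` (equality), `hsmall : (0 + 2A₁)·e^{5+1}·K₀·ν·c₁ ≤ 1` — on a member of POSITIVE tree length:
* §1 THE DATUM: W67's rod `C_R = {p₀, p₁, p₂}` on the fine torus `tsys 4 (L·N′)` (`torusTreeLen_CR : d(C_R) = 1`, `5 ≤ L`) and its two
  OVERLAPPING DOMINOES `D_A = {p₀, p₁}`, `D_B = {p₁, p₂}` as torus localization domains (`tFaceConnected_image` ∘ b13's `faceConnected_pair`);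
  `torusTreeLen_domT_le_one` ((2.30)'s upper half), the three domains pairwise DISTINCT and `D_A.1 ∪ D_B.1 = C_R.1` (`footprints`, `5 ≤ L`,
  W67's `natLift_proj_pR`);
* §2 THE ACTIVITY: the linear source pencil `H_s(Z) = s·c` on `D_A` and `D_B`, ZERO on `C_R` and on every other domain; (E1) `hhol_AB`,
  (E2) `hm_AB` with the envelope `ρc·𝟙[Z ∈ {D_A, D_B}]`, and **`hL3_AB` — the (2.38)-shape AT A LIVE RATE**: an envelope of height
  `M ≤ A·e^{−R}` on the dominoes lies under `A·e^{−R·d(Z)}` for every sub-domain (the rate is CHARGED: `d(D_A), d(D_B) ≤ 1`);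
* §3 THE LOCATED CONSTANTS (toy numerals): `R₁ := 1 + 2·(64 log 162) + 2` (`Rone_eq`: `= 1 + 2κ₀ + 2` by `torus_consts`), slope
  `A₁ := A·e^{−5}∕2` with W33's `A = Acst = (e·K₀(64,8)·9·64)⁻¹` — the merging cost `e^{b}`, `b = 5r₁`, PREPAID —, activity slope
  `c := A₁·e^{−R₁}`; **`smallness_budget_eq`: `(0 + 2A₁)·e^{5+1} = A·e^{0+1}`**, so `hsmall` at `b = 5` IS W24's `hsmall_torus` (`hsmall_AB`);
* §4 **`rodRateOne_fires`** — N0o's face ONCE BY NAME at `(r₁, b, R, A₀, A₁, ϱ, X₀) = (1, 5, R₁, 0, A₁, 2, C_R)`, conclusion LITERAL with the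
  decay factor `exp (−(1·d(C_R)))`; **`rodRateOne_fires_closed` (`5 ≤ L`): `≤ 2·K₀(64,8)·e^{−6}`** — `e^{−6}` = the prepaid `e^{−b}` times the
  COLLECTED decay `e^{−r₁·d(C_R)} = e^{−1}`; `closed_bound_lt_undecayed`: without the collected factor the same bookkeeping reads
  `2·K₀(64,8)·e^{−5}`, strictly larger.
PART 2 (`…RodRateWitnessLive`, THEOREMS ONLY, imports THIS file only): the GENERAL Kotecký–Preiss lemmas `truncatedWeight_eq_zero_of_zero_mem`
(a truncated function containing a polymer of ZERO activity vanishes), `exp_locE_of_support_single` (`exp E_w(X) = 1 + w P` — W24's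
`exp_locE_cube` for ANY footprint) and `exp_locE_of_support_pair` (`exp E_w(X) = (1 + w P + w Q)∕((1 + w P)(1 + w Q))` for an INCOMPATIBLE
pair covering `X`), and on THIS datum `exp E_{H_1}(C_R) = (1 + 2c)∕(1 + c)²` — the two-domino Ursell term, (2.13) at n = 2 —, hence
**`rodCluster_live`: `E_{H_1}(C_R) ≠ E_{H_0}(C_R)` although NO active polymer has footprint `C_R`**.

HONEST FRAMING.  A DECIDED TOY ([folklore]; 0 sorry; 0 citations; no `def … : Prop` — the `def`s are toy DATA and three numerals): the rod
is W67's, the two-domino activity and every numeral (`e^{−5}∕2`, `r₁ = 1`, `b = 5`, `ϱ = 2`) are OURS over pv22's located letters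
`κ₀ = 64 log 162`, `K₀(64,8)`, `ν = 9`, `c₁ = 64`; `hL3` ((B3)'s (2.38)-majorant at the dressed constant) is MET BY CHOICE of the activity —
NOT for Bałaban's densities (GAPS G-ne9p2-5 UNPRINTED); the referee's caveat (a) is answered about the SHAPE's rate bookkeeping ON A TOY and
says NOTHING about slack on Bałaban's densities — on a FIXED activity the rate bookkeeping redistributes the decay between the slope `A₁` and
the collected factor, it does not improve the number; no numeral of [Balaban1988RGII] ∕ [Balaban1987RGI] asserted ((2.11)–(2.13), (2.30),
(2.38)–(2.41), p. 21 «exp 5κ» = TYPE∕CONTEXT); 0 binders instantiated on Bałaban's densities; no wall item; wall v1.8 (T4-DAG v48) — words,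
not kind — does NOT move; R-t4r2-Q2 NOT met thereby; NE1′ ⇐ the named binders — NOT proved, NOT printed; spine PROVED 0∕9; count 9
unchanged.  Rung (B)+1 on ONE finite four-torus — NOT infinite volume, NOT a mass gap, NOT OS on ℝ⁴, NOT Clay.
HONEST DEPENDENCY: continuum YM on T⁴ ⇐ BetaPertH ∧ nine spine estimates (0/9 proved); BetaPertH ⇐ (D1) ∧ (D4) ∧ CAP+tail; G-an2-4
gates asym, D1 and NE2/3/4.
-/

noncomputable section

namespace Summit.QuantumFields.BalabanUV.T4Continuum.NE1p.DressedSmallFieldRodRateWitness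

open Set Metric Complex
open scoped BigOperators
open Literature.MathematicalPhysics.QuantumFieldTheory.Balaban1983to89
open Literature.MathematicalPhysics.QuantumFieldTheory.Balaban1983to89.B12TreeDecay (K₀ K₀_pos)
open Literature.MathematicalPhysics.QuantumFieldTheory.Balaban1983to89.B13Resummation (locE)
open Literature.MathematicalPhysics.QuantumFieldTheory.Balaban1983to89.B13ScaleTransfer (Pt Adj)
open Literature.MathematicalPhysics.QuantumFieldTheory.Balaban1983to89.B13Ineq232 (faceConnected_pair)
open Literature.MathematicalPhysics.QuantumFieldTheory.Balaban1983to89.TreeLengthTorus (TPt TDom tsys tsys_dj proj natLift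
  tFaceConnected_image torusTreeLen torusTreeLen_le_card_sub_one)
open Literature.MathematicalPhysics.QuantumFieldTheory.Balaban1983to89.TreeLengthTorusGeometry (tgeometry TTouch)
open Summit.QuantumFields.BalabanUV.T4Continuum.NE1p.DressedSmallFieldGeometry (attachedPart_locE_le_geom torus_consts)
open Summit.QuantumFields.BalabanUV.T4Continuum.NE1p.DressedSmallFieldGeometryFaces (K₀_four)
open Summit.QuantumFields.BalabanUV.T4Continuum.NE1p.DressedSmallFieldTorusWitness (prefactor_pos hsmall_torus)
open Summit.QuantumFields.BalabanUV.T4Continuum.NE1p.DressedSmallFieldCoresWitness (Acst Acst_pos)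
open Summit.QuantumFields.BalabanUV.T4Continuum.NE1p.DressedSmallFieldNestedToriRod (pR pR_zero adj_pR rodW rodT CR CR_val
  natLift_proj_pR torusTreeLen_CR)

/-! ## §1 THE DATUM: the two overlapping dominoes `D_A = {p₀, p₁}`, `D_B = {p₁, p₂}` of W67's rod, on the fine torus `tsys 4 (L·N′)` -/

section Datum
variable (L : ℕ)

/-- THE j-th DOMINO OF THE ROD on the window lattice (toy DATA): `{p_j, p_{j+1}} ⊂ ℤ⁴` (W67's `pR` BY NAME). [folklore] -/
def domW (j : ℕ) : Finset (Pt 4) := {pR L j, pR L (j + 1)}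

/-- A domino is face-connected (b13's `faceConnected_pair` on W67's `adj_pR`). [folklore] -/
theorem faceConnected_domW (j : ℕ) : B13ScaleTransfer.FaceConnected (domW L j) := faceConnected_pair (adj_pR L j)

/-- The window rod is the union of its two dominoes: `{p₀,p₁,p₂} = {p₀,p₁} ∪ {p₁,p₂}`. [folklore] -/
theorem rodW_eq_union : rodW L = domW L 0 ∪ domW L 1 := by
  unfold rodW domW; ext x; simp only [Finset.mem_insert, Finset.mem_singleton, Finset.mem_union]; tauto

variable (N' : ℕ)

/-- THE j-th DOMINO ON THE FINE TORUS (toy DATA): the image under `proj (L·N′)`. [folklore] -/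
def domT (j : ℕ) : Finset (TPt 4 (L * N')) := (domW L j).image (proj (L * N'))

/-- The torus rod is the union of its two torus dominoes. [folklore] -/
theorem rodT_eq_union : rodT L N' = domT L N' 0 ∪ domT L N' 1 := by
  unfold rodT domT; rw [rodW_eq_union, Finset.image_union]

/-- Each domino lies in the rod (`j ≤ 1`). [folklore] -/
theorem domT_subset_rodT {j : ℕ} (hj : j ≤ 1) : domT L N' j ⊆ rodT L N' := by
  rw [rodT_eq_union]
  interval_cases j
  exacts [Finset.subset_union_left, Finset.subset_union_right]

/-- A torus domino has at most two cubes. [folklore] -/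
theorem card_domT_le (j : ℕ) : (domT L N' j).card ≤ 2 := by
  unfold domT domW
  exact Finset.card_image_le.trans (Finset.card_insert_le _ _)

variable [NeZero L] [NeZero N']

/-- The rod's three cubes are pairwise distinct on the fine torus (`5 ≤ L`; W67's `natLift_proj_pR`). [folklore] -/
theorem proj_pR_inj (hL : 5 ≤ L) {i j : ℕ} (hi : i ≤ 2) (hj : j ≤ 2)
    (h : proj (L * N') (pR L i) = proj (L * N') (pR L j)) : i = j := by
  have h' := congrArg natLift h
  rw [natLift_proj_pR L N' hL hi, natLift_proj_pR L N' hL hj] at h'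
  have h0 := congrFun h' 0
  rw [pR_zero, pR_zero] at h0
  exact_mod_cast (by linarith : (i : ℤ) = j)

/-- `proj p₂ ∉ D_A` (`5 ≤ L`). [folklore] -/
theorem proj_pR_two_notMem_domT_zero (hL : 5 ≤ L) : proj (L * N') (pR L 2) ∉ domT L N' 0 := by
  unfold domT domW
  simp only [Finset.image_insert, Finset.image_singleton, Finset.mem_insert, Finset.mem_singleton, not_or]
  exact ⟨fun h => by have := proj_pR_inj L N' hL (by norm_num) (by norm_num) h; omega,
    fun h => by have := proj_pR_inj L N' hL (by norm_num) (by norm_num) h; omega⟩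

/-- `proj p₀ ∉ D_B` (`5 ≤ L`). [folklore] -/
theorem proj_pR_zero_notMem_domT_one (hL : 5 ≤ L) : proj (L * N') (pR L 0) ∉ domT L N' 1 := by
  unfold domT domW
  simp only [Finset.image_insert, Finset.image_singleton, Finset.mem_insert, Finset.mem_singleton, not_or]
  exact ⟨fun h => by have := proj_pR_inj L N' hL (by norm_num) (by norm_num) h; omega,
    fun h => by have := proj_pR_inj L N' hL (by norm_num) (by norm_num) h; omega⟩

/-- THE DOMINO `D_A = {p₀, p₁}` AS A TORUS LOCALIZATION DOMAIN (toy DATA; `tFaceConnected_image` BY NAME). [folklore] -/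
def DA : TDom 4 (L * N') := ⟨domT L N' 0, ⟨(Finset.insert_nonempty _ _).image _, tFaceConnected_image (faceConnected_domW L 0)⟩⟩

/-- THE DOMINO `D_B = {p₁, p₂}` AS A TORUS LOCALIZATION DOMAIN (toy DATA). [folklore] -/
def DB : TDom 4 (L * N') := ⟨domT L N' 1, ⟨(Finset.insert_nonempty _ _).image _, tFaceConnected_image (faceConnected_domW L 1)⟩⟩

/-- `D_A.1 = domT 0`. [folklore] -/ @[simp] theorem DA_val : (DA L N').1 = domT L N' 0 := rfl
/-- `D_B.1 = domT 1`. [folklore] -/ @[simp] theorem DB_val : (DB L N').1 = domT L N' 1 := rfl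

/-- **A TORUS DOMINO HAS TREE LENGTH AT MOST ONE** ((2.30)'s upper half `torusTreeLen_le_card_sub_one` BY NAME: `≤ #cubes − 1 ≤ 1`). [folklore] -/
theorem torusTreeLen_domT_le_one {j : ℕ} (hj : j ≤ 1) : torusTreeLen (domT L N' j) ≤ 1 := by
  have hne : (domT L N' j).Nonempty := by unfold domT domW; exact (Finset.insert_nonempty _ _).image _
  have hc := tFaceConnected_image (N := L * N') (faceConnected_domW L j)
  refine (torusTreeLen_le_card_sub_one hne hc).trans ?_
  have h2 : ((domT L N' j).card : ℝ) ≤ 2 := by exact_mod_cast card_domT_le L N' j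
  interval_cases j <;> linarith

/-- **THE TWO DOMINOES AND THE ROD ARE THREE DISTINCT TORUS DOMAINS** (`5 ≤ L`). [folklore] -/
theorem DA_ne_DB (hL : 5 ≤ L) : DA L N' ≠ DB L N' := fun h => by
  have h0 : proj (L * N') (pR L 0) ∈ (DA L N').1 := by
    rw [DA_val]; unfold domT domW; exact Finset.mem_image_of_mem _ (by simp)
  rw [h, DB_val] at h0
  exact proj_pR_zero_notMem_domT_one L N' hL h0

/-- `D_A ≠ C_R`. [folklore] -/
theorem DA_ne_CR (hL : 5 ≤ L) : DA L N' ≠ CR L N' := fun h => by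
  have h2 : proj (L * N') (pR L 2) ∈ (CR L N').1 := by
    rw [CR_val]; unfold rodT rodW; exact Finset.mem_image_of_mem _ (by simp)
  rw [← h, DA_val] at h2
  exact proj_pR_two_notMem_domT_zero L N' hL h2

/-- `D_B ≠ C_R`. [folklore] -/
theorem DB_ne_CR (hL : 5 ≤ L) : DB L N' ≠ CR L N' := fun h => by
  have h0 : proj (L * N') (pR L 0) ∈ (CR L N').1 := by
    rw [CR_val]; unfold rodT rodW; exact Finset.mem_image_of_mem _ (by simp)
  rw [← h, DB_val] at h0
  exact proj_pR_zero_notMem_domT_one L N' hL h0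

/-- The footprints: `D_A.1 ∪ D_B.1 = C_R.1`, `D_A.1 ≠ C_R.1`, `D_B.1 ≠ C_R.1` (`5 ≤ L`). [folklore] -/
theorem footprints (hL : 5 ≤ L) :
    (DA L N').1 ∪ (DB L N').1 = (CR L N').1 ∧ (DA L N').1 ≠ (CR L N').1 ∧ (DB L N').1 ≠ (CR L N').1 :=
  ⟨by rw [DA_val, DB_val, CR_val, rodT_eq_union],
    fun h => DA_ne_CR L N' hL (Subtype.ext h), fun h => DB_ne_CR L N' hL (Subtype.ext h)⟩

end Datum

/-! ## §2 THE ACTIVITY: a linear source pencil on the two dominoes, ZERO on the rod and on every other domain -/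

section Activity
variable (L N' : ℕ) [NeZero L] [NeZero N']

open Classical in
/-- THE TWO-DOMINO ACTIVITY PENCIL (toy DATA): `H_s(Z) = s·c` on `D_A` and on `D_B`, `0` on every other domain of the fine torus —
in particular `0` on the rod `C_R` itself. [folklore] -/
def actAB (c : ℝ) (s : ℂ) (Z : TDom 4 (L * N')) : ℂ := if Z = DA L N' ∨ Z = DB L N' then s * c else 0

open Classical in
/-- THE ENVELOPE (toy DATA): `M` on the two dominoes, `0` elsewhere. [folklore] -/
def envAB (M : ℝ) (Z : TDom 4 (L * N')) : ℝ := if Z = DA L N' ∨ Z = DB L N' then M else 0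

/-- The pencil on `D_A`. [folklore] -/
@[simp] theorem actAB_DA (c : ℝ) (s : ℂ) : actAB L N' c s (DA L N') = s * c := by
  unfold actAB; exact if_pos (Or.inl rfl)

/-- The pencil on `D_B`. [folklore] -/
@[simp] theorem actAB_DB (c : ℝ) (s : ℂ) : actAB L N' c s (DB L N') = s * c := by
  unfold actAB; exact if_pos (Or.inr rfl)

/-- The pencil vanishes off the two dominoes. [folklore] -/
theorem actAB_of_ne (c : ℝ) (s : ℂ) {Z : TDom 4 (L * N')} (hA : Z ≠ DA L N') (hB : Z ≠ DB L N') : actAB L N' c s Z = 0 := by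
  unfold actAB; exact if_neg (not_or.2 ⟨hA, hB⟩)

/-- At the origin of the source the pencil is the zero activity. [folklore] -/
@[simp] theorem actAB_zero (c : ℝ) (Z : TDom 4 (L * N')) : actAB L N' c 0 Z = 0 := by
  unfold actAB; split_ifs <;> simp

/-- (E1): every activity of the pencil is holomorphic in the source (linear or zero). [folklore] -/
theorem hhol_AB (c ρ : ℝ) (X : (tsys 4 (L * N')).Dom) :
    ∀ Z : (tsys 4 (L * N')).Dom, (tgeometry 4 (L * N')).cubes Z ⊆ (tgeometry 4 (L * N')).cubes X →
      DifferentiableOn ℂ (fun s => actAB L N' c s Z) (ball (0 : ℂ) ρ) := by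
  intro Z _; unfold actAB; split_ifs
  exacts [(differentiable_id.mul_const (c : ℂ)).differentiableOn, differentiableOn_const _]

/-- (E2): on the source ball of radius `ρ` the pencil of slope `c ≥ 0` is dominated by the envelope `ρ·c·𝟙[Z ∈ {D_A, D_B}]`. [folklore] -/
theorem hm_AB {c ρ : ℝ} (hc : 0 ≤ c) (X : (tsys 4 (L * N')).Dom) :
    ∀ s ∈ ball (0 : ℂ) ρ, ∀ Z : (tsys 4 (L * N')).Dom, (tgeometry 4 (L * N')).cubes Z ⊆ (tgeometry 4 (L * N')).cubes X →
      ‖actAB L N' c s Z‖ ≤ envAB L N' (ρ * c) Z := by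
  intro s hs Z _; unfold actAB envAB; split_ifs
  · rw [norm_mul, Complex.norm_real, Real.norm_eq_abs, abs_of_nonneg hc]
    exact mul_le_mul_of_nonneg_right (mem_ball_zero_iff.1 hs).le hc
  · simp

/-- **THE (2.38)-SHAPE AT A LIVE RATE**: an envelope of height `M ≤ A·e^{−R}` on the two dominoes (tree length `≤ 1`, §1) lies under
`A·e^{−R·d(Z)}` for EVERY sub-domain `Z` — the rate `R` is charged on domains of POSITIVE tree length. [folklore] -/
theorem hL3_AB {M A R : ℝ} (hA : 0 ≤ A) (hR : 0 ≤ R) (hM : M ≤ A * Real.exp (-R)) (X : (tsys 4 (L * N')).Dom) :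
    ∀ Z : (tsys 4 (L * N')).Dom, (tgeometry 4 (L * N')).cubes Z ⊆ (tgeometry 4 (L * N')).cubes X →
      envAB L N' M Z ≤ A * Real.exp (-(R * (tsys 4 (L * N')).dj Z)) := by
  intro Z _; unfold envAB; split_ifs with h
  · have hd : (tsys 4 (L * N')).dj Z ≤ 1 := by
      rw [tsys_dj]
      rcases h with rfl | rfl
      · rw [DA_val]; exact torusTreeLen_domT_le_one L N' (by norm_num)
      · rw [DB_val]; exact torusTreeLen_domT_le_one L N' (by norm_num)
    refine hM.trans (mul_le_mul_of_nonneg_left (Real.exp_le_exp.2 ?_) hA)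
    nlinarith [(tsys 4 (L * N')).dj_nonneg Z]
  · positivity

end Activity

/-! ## §3 THE LOCATED CONSTANTS OF THE RATE-ONE BOOKKEEPING: R = 1 + 2κ₀ + 2, b = 5, slope A₁ = A·e^{−5}∕2, activity slope c = A₁·e^{−R} -/

section Constants

/-- THE RATE (toy numeral): `R₁ := 1 + 2·(64·log 162) + 2` — `hrate : r₁ + 2κ₀ + 2 ≤ R` WITH EQUALITY at `r₁ = 1` (pv22's κ₀ = 64·log 162). [folklore] -/
def Rone : ℝ := 1 + 2 * (64 * Real.log 162) + 2

/-- `R₁ = 1 + 2κ₀ + 2` on every four-torus (`torus_consts`). [folklore] -/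
theorem Rone_eq (M : ℕ) [NeZero M] : (1 : ℝ) + 2 * (tgeometry 4 M).κ₀ + 2 = Rone := by rw [(torus_consts M).2.1]; rfl

/-- `0 < R₁`. [arith] -/
theorem Rone_pos : 0 < Rone := by
  unfold Rone; have := Real.log_pos (by norm_num : (1 : ℝ) < 162); positivity

/-- THE SLOPE OF THE AFFINE MAJORANT (toy numeral): `A₁ := A·e^{−5}∕2`, `A = (e·K₀(64,8)·9·64)⁻¹` W33's `Acst` BY NAME — the merging cost
`e^{b}`, `b = 5r₁ = 5`, PREPAID so that `hsmall` holds at `b = 5`. [folklore] -/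
def Aone : ℝ := Acst * Real.exp (-5) / 2

/-- `0 < A₁`. [arith] -/
theorem Aone_pos : 0 < Aone := by unfold Aone; have := Acst_pos; positivity

/-- THE ACTIVITY SLOPE (toy numeral): `c := A₁·e^{−R₁}` — so that on the source ball of radius `2` the envelope `2c = (0 + 2A₁)·e^{−R₁·1}`
meets `hL3` at the dominoes with the rate CHARGED. [folklore] -/
def cAB : ℝ := Aone * Real.exp (-Rone)

/-- `0 < c`. [arith] -/
theorem cAB_pos : 0 < cAB := by unfold cAB; have := Aone_pos; positivity

/-- The envelope height meets `hL3`'s premise with equality: `2c = (0 + 2A₁)·e^{−R₁}`. [arith] -/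
theorem two_cAB_eq : 2 * cAB = (0 + 2 * Aone) * Real.exp (-Rone) := by unfold cAB; ring

/-- **THE «ε SMALL» CLAUSE AT `b = 5` IS W24's CLAUSE AT `b = 0`**: `(0 + 2A₁)·e^{5+1} = A·e^{0+1}` — the prepaid `e^{−5}` cancels the
merging cost. [arith] -/
theorem smallness_budget_eq : (0 + 2 * Aone) * Real.exp (5 + 1) = (Real.exp 1 * K₀ 64 8 * 9 * 64)⁻¹ * Real.exp (0 + 1) := by
  unfold Aone Acst
  rw [Real.exp_add, zero_add, zero_add, Real.exp_neg]
  have h5 : Real.exp 5 ≠ 0 := (Real.exp_pos 5).ne'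
  field_simp

/-- **`hsmall` AT `b = 5` HOLDS** on every four-torus (W24's `hsmall_torus` BY NAME after `smallness_budget_eq`). [folklore] -/
theorem hsmall_AB (M : ℕ) [NeZero M] :
    (0 + 2 * Aone) * Real.exp (5 + 1) * (tgeometry 4 M).K₀ * (tgeometry 4 M).ν * (tgeometry 4 M).c₁ ≤ 1 := by
  rw [smallness_budget_eq]; exact hsmall_torus M

end Constants

/-! ## §4 THE FACE FIRES AT RATE ONE ON THE ROD — N0o's `attachedPart_locE_le_geom` applied ONCE BY NAME -/

section Fires
variable (L N' : ℕ) [NeZero L] [NeZero N']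

open Classical in
/-- **THE OWNER's TORUS FACE FIRES IN THE INTERIOR OF ITS RATE BOOKKEEPING** [decided toy]: `attachedPart_locE_le_geom` at
`(tsys 4 (L·N′), tgeometry 4 (L·N′))` with `r₁ := 1`, `b := 5`, `R := R₁ = 1 + 2κ₀ + 2` (`hb`, `hrate` WITH EQUALITY, `hsmall` by §3),
`A₀ := 0`, `A₁ := A·e^{−5}∕2`, `ϱ := 2`, member `X₀ := C_R` (W67's rod), activity `actAB c`, envelope `envAB (2c)`; (E1)∕(E2)∕`hL3` by §2.
Conclusion LITERAL, with the decay factor `exp (−(1 · d(C_R)))`. [folklore] -/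
theorem rodRateOne_fires :
    ‖locE (tgeometry 4 (L * N')).ι (tgeometry 4 (L * N')).cubes (actAB L N' cAB 1) ((tgeometry 4 (L * N')).cubes (CR L N')) -
        locE (tgeometry 4 (L * N')).ι (tgeometry 4 (L * N')).cubes (actAB L N' cAB 0) ((tgeometry 4 (L * N')).cubes (CR L N'))‖ ≤
      4 * (Real.exp 1 * (tgeometry 4 (L * N')).ν * (tgeometry 4 (L * N')).c₁ * (tgeometry 4 (L * N')).K₀ ^ 2) * Aone *
        Real.exp (-(1 * (tsys 4 (L * N')).dj (CR L N'))) :=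
  attachedPart_locE_le_geom (tsys 4 (L * N')) (tgeometry 4 (L * N')) (m := envAB L N' (2 * cAB)) (act := actAB L N' cAB)
    (A₀ := 0) (A₁ := Aone) (R := Rone) (r₁ := 1) (b := 5) (ϱ := 2) (X₀ := CR L N')
    le_rfl Aone_pos.le zero_le_one (by norm_num) (Rone_eq (L * N')).le (hsmall_AB (L * N'))
    (hhol_AB L N' cAB 2 (CR L N')) (hm_AB L N' (ρ := 2) cAB_pos.le (CR L N'))
    (hL3_AB L N' (by have := Aone_pos; positivity) Rone_pos.le (two_cAB_eq.le) (CR L N')) le_rfl (by have := Aone_pos; positivity)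

open Classical in
/-- **… IN CLOSED FORM, THE DECAY COLLECTED**: `d(C_R) = 1` (W67's `torusTreeLen_CR`, `5 ≤ L`), so the bound reads
`4·(e·9·64·K₀(64,8)²)·(A·e^{−5}∕2)·e^{−1} = 2·K₀(64,8)·e^{−6}` (pv22's constants by `torus_consts`∕`K₀_four` BY NAME): the factor `e^{−6}`
= the prepaid merging cost `e^{−b}` times the collected decay `e^{−r₁·d(C_R)}`. [folklore] -/
theorem rodRateOne_fires_closed (hL : 5 ≤ L) :
    ‖locE (tgeometry 4 (L * N')).ι (tgeometry 4 (L * N')).cubes (actAB L N' cAB 1) ((tgeometry 4 (L * N')).cubes (CR L N')) -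
        locE (tgeometry 4 (L * N')).ι (tgeometry 4 (L * N')).cubes (actAB L N' cAB 0) ((tgeometry 4 (L * N')).cubes (CR L N'))‖ ≤
      2 * K₀ 64 8 * Real.exp (-6) := by
  refine (rodRateOne_fires L N').trans (le_of_eq ?_)
  rw [(torus_consts (L * N')).1, (torus_consts (L * N')).2.2, K₀_four, tsys_dj, torusTreeLen_CR L N' hL]
  unfold Aone Acst
  rw [show (-6 : ℝ) = -5 + -(1 * 1) by norm_num, Real.exp_add (-5)]
  have hK := K₀_pos (64 : ℝ) 8
  have he := Real.exp_pos 1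
  field_simp
  norm_num

/-- **THE DECAY IS LOAD-BEARING IN THE NUMBER**: without the collected factor `e^{−r₁·d(C_R)} = e^{−1}` the same bookkeeping would read
`2·K₀(64,8)·e^{−5}`, a STRICTLY larger number. [arith] -/
theorem closed_bound_lt_undecayed : 2 * K₀ 64 8 * Real.exp (-6) < 2 * K₀ 64 8 * Real.exp (-5) := by
  have hK := K₀_pos (64 : ℝ) 8
  have h : Real.exp (-6) < Real.exp (-5) := Real.exp_lt_exp.2 (by norm_num)
  nlinarith

end Fires

end Summit.QuantumFields.BalabanUV.T4Continuum.NE1p.DressedSmallFieldRodRateWitness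

end
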